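import Summits.Ventures.HodgeRepro2.T5InertSatakeSets

/-!
# Towards the Iwasawa decomposition of `U(2,1)` at an inert place, part 1: clearing the bottom row by `K`
(cell pub-hodge-repro2, seat p3)

Tier-5 N3 support. The Macdonald–Satake identification of files 216–217 takes the Iwasawa decomposition
`G = N {a_m} K` as a hypothesis; this file starts its proof. For `g ∈ U(J₃(u))` with bottom row `(p, q, r)`
(isotropic: `r p̄ + q q̄ / u + p r̄ = 0`, p8's `row_relations`) and `r ≠ 0`, ONE lower unipotent
`n⁻(y, w) = lower3 u y w` with `y = q̄ / (u r̄)`, `w = −(p + q y) / r` clears the first two entries of the bottom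
row of `g n⁻(y, w)` — and the unitary relation `w + w̄ + u ȳ y = 0` that puts `n⁻(y, w)` in `U(J₃(u))` IS the
isotropy of `(p, q, r)`. When `r` is a unit and `p, q` are integral, `n⁻(y, w) ∈ K`. The Weyl element `w₀`
(p8's `permUnit`) swaps the roles of `p` and `r`.

* `coe_mul_lower3` — the matrix of `g n⁻(y, w)`;
* **`exists_lower3_mul_eq`** — the clearing lemma (`r ≠ 0`): `g n⁻(y, w) = !![*, *, *; *, *, *; 0, 0, r]`,
  `n⁻(y, w) ∈ U(J₃(u))`;
* **`lower3_mem_hyperspecial`** — `n⁻(y, w) ∈ K` when `p, q ∈ R`, `r ∈ Rˣ`;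
* `permUnit_rev3_mem_hyperspecial`, `coe_mul_permUnit_rev3` — the Weyl element is in `K` and swaps `p ↔ r`.

Mathlib + this seat's file 211 and its imports; no display; no device.
§8(d): uses an L-value-free non-vanishing device: NO.
-/

namespace Summit.Ventures.HodgeRepro2.T5InertIwasawaRow

open Matrix
open Summit.Ventures.HodgeRepro2.T5HermitianThreeElements Summit.Ventures.HodgeRepro2.T5UnitaryGroupForm
  Summit.Ventures.HodgeRepro2.T5UnitaryHeckeAdjoint Summit.Ventures.HodgeRepro2.T5UnitaryThreeCorner

section Clearing

variable {E : Type*} [Field E] [StarRing E] (u : E) (hsu : star u = u) (hu0 : u ≠ 0)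

/-- The matrix of `g · n⁻(y, w)`. -/
theorem coe_mul_lower3 (g : GL (Fin 3) E) (a b c d e f p q r : E) (hg : (g : Matrix (Fin 3) (Fin 3) E) =
    !![a, b, c; d, e, f; p, q, r]) (y w : E) :
    ((g * lower3 u y w : GL (Fin 3) E) : Matrix (Fin 3) (Fin 3) E) =
      !![a + b * y + c * w, b + c * (-(u * star y)), c; d + e * y + f * w, e + f * (-(u * star y)), f;
        p + q * y + r * w, q + r * (-(u * star y)), r] := by
  rw [Units.val_mul, hg, coe_lower3, Matrix.mul_fin_three, fin_three_eq_iff]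
  refine ⟨by ring, by ring, by ring, by ring, by ring, by ring, by ring, by ring, by ring⟩

include hsu hu0 in
/-- **The clearing lemma.** For `g ∈ U(J₃(u))` with bottom row `(p, q, r)`, `r ≠ 0`: with `y = q̄ / (u r̄)` and
`w = −(p + q y) / r`, `n⁻(y, w) ∈ U(J₃(u))` (the unitary relation is the isotropy of the bottom row) and
`g n⁻(y, w)` has bottom row `(0, 0, r)`. -/
theorem exists_lower3_mul_eq (g : GL (Fin 3) E) (hg' : g ∈ formUnitaryGroup (J3 u)) (a b c d e f p q r : E)
    (hg : (g : Matrix (Fin 3) (Fin 3) E) = !![a, b, c; d, e, f; p, q, r]) (hr : r ≠ 0) :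
    lower3 u (star q / (u * star r)) (-(p + q * (star q / (u * star r))) / r) ∈ formUnitaryGroup (J3 u) ∧
      ∃ a' b' c' d' e' f' : E,
        ((g * lower3 u (star q / (u * star r)) (-(p + q * (star q / (u * star r))) / r) : GL (Fin 3) E) :
          Matrix (Fin 3) (Fin 3) E) = !![a', b', c'; d', e', f'; 0, 0, r] := by
  have hrel := (row_relations u hu0 g a b c d e f p q r hg hg').2.2.2.2.2.2.2.2
  have hr' : star r ≠ 0 := star_ne_zero.2 hr
  have hsy : star (star q / (u * star r)) = q / (u * r) := by
    rw [star_div₀, star_star, star_mul, hsu, star_star, mul_comm]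
  refine ⟨lower3_mem u hsu ?_, a + b * (star q / (u * star r)) + c * (-(p + q * (star q / (u * star r))) / r),
    b + c * (-(u * star (star q / (u * star r)))), c,
    d + e * (star q / (u * star r)) + f * (-(p + q * (star q / (u * star r))) / r),
    e + f * (-(u * star (star q / (u * star r)))), f, ?_⟩
  · -- `w + w̄ + u ȳ y = 0` is the isotropy `r p̄ + q q̄ / u + p r̄ = 0`
    have key : -(p + q * (star q / (u * star r))) / r + star (-(p + q * (star q / (u * star r))) / r) +
        u * star (star q / (u * star r)) * (star q / (u * star r)) =
        -(r * star p + q * u⁻¹ * star q + p * star r) / (r * star r) := by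
      rw [star_div₀, star_neg, star_add, star_mul, hsy]
      field_simp
      ring
    rw [key, hrel, neg_zero, zero_div]
  · rw [coe_mul_lower3 u g a b c d e f p q r hg, fin_three_eq_iff]
    refine ⟨rfl, rfl, rfl, rfl, rfl, rfl, ?_, ?_, rfl⟩
    · field_simp
      ring
    · rw [hsy]
      field_simp
      ring

end Clearing

section Integral

variable {R E : Type*} [CommRing R] [Field E] [StarRing E] [Algebra R E] [IsFractionRing R E]
  (hstar : ∀ x : E, IsLocalization.IsInteger R x → IsLocalization.IsInteger R (star x))
  (u : E) (hsu : star u = u) (hu0 : u ≠ 0) (hu : IsLocalization.IsInteger R u)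
  (hu' : IsLocalization.IsInteger R u⁻¹)

include hstar hsu hu0 hu' in
/-- **`n⁻(y, w) ∈ K`** for the clearing data when `p, q` are integral and `r⁻¹` is integral (`r` a unit of `R`). -/
theorem lower3_mem_hyperspecial {p q r : E} (hp : IsLocalization.IsInteger R p) (hq : IsLocalization.IsInteger R q)
    (hr' : IsLocalization.IsInteger R r⁻¹) (hr0 : r ≠ 0)
    (hmem : lower3 u (star q / (u * star r)) (-(p + q * (star q / (u * star r))) / r) ∈ formUnitaryGroup (J3 u)) :
    (⟨lower3 u (star q / (u * star r)) (-(p + q * (star q / (u * star r))) / r), hmem⟩ :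
      formUnitaryGroup (J3 u)) ∈ hyperspecialSubgroup R (J3 u) := by
  rw [mem_hyperspecialSubgroup_iff]
  have hy : IsLocalization.IsInteger R (star q / (u * star r)) := by
    rw [div_eq_mul_inv, mul_inv, ← mul_assoc]
    exact IsLocalization.isInteger_mul (IsLocalization.isInteger_mul (hstar _ hq) hu') (isInteger_star_inv hstar hr')
  refine lower3_mem_range hy ?_ ?_
  · rw [div_eq_mul_inv]
    exact IsLocalization.isInteger_mul (isInteger_neg (IsLocalization.isInteger_add hp
      (IsLocalization.isInteger_mul hq hy))) hr'
  · have hsy : star (star q / (u * star r)) = q / (u * r) := by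
      rw [star_div₀, star_star, star_mul, hsu, star_star, mul_comm]
    rw [hsy]
    have : u * (q / (u * r)) = q * r⁻¹ := by field_simp
    rw [this]
    exact IsLocalization.isInteger_mul hq hr'

omit [IsFractionRing R E] in
/-- The Weyl element `w₀ = antidiag(1, 1, 1)` lies in `K`. -/
theorem permUnit_rev3_mem_hyperspecial :
    (⟨T5CartanDominant.permUnit E Fin.revPerm, permUnit_rev3_mem u⟩ : formUnitaryGroup (J3 u)) ∈
      hyperspecialSubgroup R (J3 u) := by
  rw [mem_hyperspecialSubgroup_iff]
  exact permUnit_rev3_mem_range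

end Integral

end Summit.Ventures.HodgeRepro2.T5InertIwasawaRow
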